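import Literature.AnabelianGeometry.AbsoluteAnabelian.ProfiniteOuterSemidirectProductTopology
import Literature.AnabelianGeometry.SemiGraphs.OuterSemidirectProductProfinite
import HarnessLib

/-!
# A continuous `θ : J → Out(G)` is continuous along the characteristic levels ([SemiAnbd] §0 p. 5)

Mochizuki, *Semi-graphs of anabelioids*, Publ. RIMS **42** (2006), §0 p. 5 [cite: MochizukiSemiAnbd2006, §0 p.5].

PROOF-ONLY bridge (abc-iut cell, GAP row «G-P13-GR», abc-iut-w5-d151 g4) between the two routes to the
profinite `G ⋊^out J` now in the tree:

* abc-iut-w5-d151's `ProfiniteOuterSemidirectProduct*.lean` (input: a CONTINUOUS homomorphism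
  `θ : J →ₜ* outProfinite hG` into the profinite `Out(G)`; output `outerSemidirectProfinite hG θ`), and
* abc-iut-L3-d5's `OuterSemidirectProductProfinite.lean` (input: an algebraic `ρ : J →* TopOut G` plus
  the hypothesis `hcont` "the outer action is continuous along the levels `charOpenCore G d`"; output
  `exists_profinite_topology`).

`levels_continuous_of_continuous`: for `ρ := outerActionOfContinuous hG θ` the hypothesis `hcont` HOLDS —
the congruence set at level `d` contains `θ⁻¹ (outProj '' {a | a_d = 1})`, the preimage of the OPEN image
(quotient maps of topological groups are open) of the open level kernel of `profiniteAut hG`.  Hence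
L3-d5's eleven-fold summary applies verbatim to every continuous `θ`
(`exists_profinite_topology_of_continuous`), and by `levelTopology_eq_coinduced` it describes the same
topological group as `outerSemidirectProfinite hG θ`.  Nothing here bears on [IUTchIII] Cor. 3.12.
-/

namespace Literature.AnabelianGeometry.AbsoluteAnabelian

open Literature.AnabelianGeometry.EtaleTheta Literature.AnabelianGeometry.SemiGraphs
open Filter Topology

universe u

variable {G : Type u} [Group G] [TopologicalSpace G] [IsTopologicalGroup G] [CompactSpace G]
  [TotallyDisconnectedSpace G] (hG : IsTopologicallyFinitelyGenerated G)
  {J : Type u} [Group J] [TopologicalSpace J] (θ : J →ₜ* outProfinite hG)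

/-- **A continuous `θ : J → Out(G)` is continuous along the characteristic levels**: the set of `j`
admitting a lift `(α, j) ∈ G ⋊^out J` with `α ≡ id (mod V_d)` is a neighbourhood of `1` — it contains
the `θ`-preimage of the open image of the level-`d` kernel of `profiniteAut hG` in `Out(G)`.
[cite: MochizukiSemiAnbd2006, §0 p.5] -/
theorem levels_continuous_of_continuous (d : ℕ) :
    {j : J | ∃ e : outerSemidirectProduct (outerActionOfContinuous hG θ),
      (∀ g : G, g⁻¹ * ((e.1.1 : contMulAut G) : MulAut G) g ∈ charOpenCore G d) ∧ e.1.2 = j} ∈ 𝓝 (1 : J) := by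
  haveI : (innProfinite hG).Normal := range_conjProfiniteAut_normal hG
  -- the open image of the level kernel in `Out(G)`
  set B : Set (profiniteAut hG) := {a | (a.1 d : contMulAut G ⧸ autLevelKer G d) = 1} with hB
  have hBo : IsOpen B := isOpen_profiniteAut_level hG d
  have hUo : IsOpen (outProj hG '' B) := QuotientGroup.isOpenMap_coe B hBo
  have h1U : θ 1 ∈ outProj hG '' B := ⟨1, rfl, by rw [map_one, map_one]⟩
  refine Filter.mem_of_superset (θ.continuous.continuousAt.preimage_mem_nhds (hUo.mem_nhds h1U)) ?_
  rintro j ⟨a, ha, hja⟩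
  -- `e := (Ψ⁻¹ a, j)` lies in the outer semi-direct product and is congruent to `id` mod `V_d`
  have hmem : ((profiniteAutEquiv (hG := hG)).symm a, j) ∈
      outerSemidirectProduct (outerActionOfContinuous hG θ) := by
    change TopOut.mk G ((profiniteAutEquiv (hG := hG)).symm a) = outerActionOfContinuous hG θ j
    apply (outEquiv hG).injective
    rw [outEquiv_mk, MulEquiv.apply_symm_apply, outEquiv_outerActionOfContinuous]
    exact hja
  exact ⟨⟨_, hmem⟩, mem_autLevelKer_iff.mp (symm_mem_autLevelKer_of_level_eq_one hG ha), rfl⟩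

variable [IsTopologicalGroup J] [CompactSpace J] [TotallyDisconnectedSpace J]

/-- **abc-iut-L3-d5's summary for a continuous `θ`**: along the characteristic levels the algebraic
`G ⋊^out J` for `ρ := outerActionOfContinuous hG θ` carries a profinite group topology with
`1 → G → G ⋊^out J → J → 1` topologically exact (`exists_profinite_topology`, its `hcont` discharged by
`levels_continuous_of_continuous`); by `levelTopology_eq_coinduced` this is the topology of
`outerSemidirectProfinite hG θ`. [cite: MochizukiSemiAnbd2006, §0 p.5] -/
theorem exists_profinite_topology_of_continuous (hZ : Subgroup.center G = ⊥) :
    ∃ τ : TopologicalSpace (outerSemidirectProduct (outerActionOfContinuous hG θ)),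
      τ = outerSemidirectProduct.topology (outerActionOfContinuous hG θ) (charOpenCore G)
        outerSemidirectProduct.charOpenCore_directed
        (outerSemidirectProduct.charOpenCore_outerInvariant (outerActionOfContinuous hG θ)) ∧
      @IsTopologicalGroup _ τ _ ∧ @CompactSpace _ τ ∧ @T2Space _ τ ∧ @TotallyDisconnectedSpace _ τ ∧
      @IsClosedEmbedding _ _ _ τ (toOuterSemidirectProduct (outerActionOfContinuous hG θ)) ∧
      @Continuous _ _ τ _ (outerSemidirectProductSnd (outerActionOfContinuous hG θ)) ∧
      @IsOpenMap _ _ τ _ (outerSemidirectProductSnd (outerActionOfContinuous hG θ)) ∧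
      Function.Injective (toOuterSemidirectProduct (outerActionOfContinuous hG θ)) ∧
      (toOuterSemidirectProduct (outerActionOfContinuous hG θ)).range =
        (outerSemidirectProductSnd (outerActionOfContinuous hG θ)).ker ∧
      Function.Surjective (outerSemidirectProductSnd (outerActionOfContinuous hG θ)) :=
  outerSemidirectProduct.exists_profinite_topology (outerActionOfContinuous hG θ) hG hZ
    (levels_continuous_of_continuous hG θ)

end Literature.AnabelianGeometry.AbsoluteAnabelian
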